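import Literature.AlgebraicGeometry.Resolution.ValuedFunctionFieldsLemmas
import Literature.AlgebraicGeometry.Resolution.KnafKuhlmann2009Prop23
import Mathlib.FieldTheory.SeparablyGenerated
import HarnessLib

/-!
# Mac Lane's criterion in the ambient vocabulary (`stub_separablyGenerated_of_linDisjoint`)

Stub of the birth line of the crux `ShadowsUniformize` (route `AbhyankarShadows`), branch
`lurelDenseAbhyankar` (Knaf–Kuhlmann 2009, Thm. 1.5: rational places in the completion of an
Abhyankar subfunction field `F₀`). Knaf–Kuhlmann 2009, Prop. 3.11 needs a SEPARATING
transcendence basis of `K' | F₀`; Lemma 3.12 there supplies linear disjointness of `K'` from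
`F₀^{1/p}` over `F₀`, and Mac Lane's criterion (Lang, *Algebra*, VIII §4; Mathlib's
`exists_isTranscendenceBasis_and_isSeparable_of_linearIndepOn_pow_of_essFiniteType`,
Stacks 030W) turns it into separable generation. This file is that last step, in the ambient
rendering of `ValuedFunctionFields.lean`.

Setting: `Ω` an algebraically closed field of characteristic `p > 0`, subfields `F₀ ≤ K'` of
`Ω` with `K' | F₀` finitely generated (`FGOver`).

Hypothesis (linear disjointness from `F₀^{1/p}`, elementwise): whenever `s₁, …, sₙ ∈ K'` are
`F₀`-linearly independent and `d₁, …, dₙ ∈ Ω` satisfy `dᵢ ^ p ∈ F₀` and `∑ dᵢ sᵢ = 0`, all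
`dᵢ` vanish.

Claim: `K' | F₀` is separably generated (`SeparablyGeneratedOver F₀ K'`): a finite `t ⊆ K'`,
algebraically independent over `F₀`, with every element of `K'` separable over `F₀(t)`.

Proof: view `K'` as the intermediate field `L := Subfield.extendScalars hle` of `Ω | F₀`; it is
`F₀(s)` for the finite generating set `s`, hence essentially of finite type over `F₀`. Mac
Lane's hypothesis "`F₀`-linearly independent finite families in `L` have `F₀`-linearly
independent `p`-th powers" follows from the linear disjointness: a relation
`∑ cₓ x ^ p = 0` (`cₓ ∈ F₀`) becomes `(∑ dₓ x) ^ p = 0` with `dₓ := cₓ^{1/p} ∈ Ω` (`Ω` is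
algebraically closed), so `∑ dₓ x = 0`, so all `dₓ = 0`, so all `cₓ = 0`. Mathlib's theorem then
gives a finite transcendence basis `s₀` of `L | F₀` with `L | F₀(s₀)` separable, and `t := s₀`
read in `Ω` is the required separating transcendence basis (algebraic independence and
separability are transported along the inclusion `L → Ω`, exactly as in
`separablyGeneratedOver_of_perfectField` of `ValuedFunctionFieldsLemmas.lean`).
-/

noncomputable section

-- single-problem summit: the doubled namespace component is forced
set_option linter.dupNamespace false

open Literature.AlgebraicGeometry.Resolution

namespace Summit.ResolutionOfSingularities.ResolutionOfSingularities.Theorems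

/-- The elementwise linear-disjointness hypothesis of `stub_separablyGenerated_of_linDisjoint`,
stated for families indexed by `Fin n`, holds for families indexed by any finite type
(reindex along `Fintype.equivFin`). [folklore] -/
theorem linDisjoint_of_fintype {Ω : Type} [Field Ω] (p : ℕ) (F₀ K' : Subfield Ω)
    (hld : ∀ (n : ℕ) (d s : Fin n → Ω), (∀ i, d i ^ p ∈ F₀) → (∀ i, s i ∈ K') →
      LinearIndependent F₀ s → ∑ i, d i * s i = 0 → ∀ i, d i = 0)
    {ι : Type} [Fintype ι] (d s : ι → Ω) (hd : ∀ i, d i ^ p ∈ F₀) (hs : ∀ i, s i ∈ K')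
    (hli : LinearIndependent F₀ s) (hsum : ∑ i, d i * s i = 0) : ∀ i, d i = 0 := by
  obtain ⟨e⟩ : Nonempty (Fin (Fintype.card ι) ≃ ι) := ⟨(Fintype.equivFin ι).symm⟩
  have hsum' : ∑ j, (d ∘ e) j * (s ∘ e) j = 0 :=
    (Fintype.sum_equiv e (fun j => (d ∘ e) j * (s ∘ e) j) (fun i => d i * s i)
      fun _ => rfl).trans hsum
  have h := hld (Fintype.card ι) (d ∘ e) (s ∘ e) (fun j => hd (e j)) (fun j => hs (e j))
    (hli.comp e e.injective) hsum'
  intro i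
  simpa using h (e.symm i)

/-- **Mac Lane's criterion, ambient form** (Lang, *Algebra*, VIII §4, Prop. 4.1 / Cor. 4.4;
Stacks 030W; used in Knaf–Kuhlmann 2009, proof of Lemma 3.12 / Prop. 3.11). Let `Ω` be an
algebraically closed field of characteristic `p > 0` and `F₀ ≤ K'` subfields with `K' | F₀`
finitely generated. If `K'` is linearly disjoint from `F₀^{1/p}` over `F₀` — elementwise: for
`F₀`-linearly independent `s₁, …, sₙ ∈ K'` and `d₁, …, dₙ ∈ Ω` with `dᵢ ^ p ∈ F₀`,
`∑ dᵢ sᵢ = 0` forces all `dᵢ = 0` — then `K' | F₀` is separably generated. [folklore] -/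
theorem stub_separablyGenerated_of_linDisjoint {Ω : Type} [Field Ω] [IsAlgClosed Ω] (p : ℕ)
    [Fact p.Prime] [CharP Ω p] (F₀ K' : Subfield Ω) (hle : F₀ ≤ K') (hfg : FGOver F₀ K')
    (hld : ∀ (n : ℕ) (d s : Fin n → Ω), (∀ i, d i ^ p ∈ F₀) → (∀ i, s i ∈ K') →
      LinearIndependent F₀ s → ∑ i, d i * s i = 0 → ∀ i, d i = 0) :
    SeparablyGeneratedOver F₀ K' := by
  classical
  have hp : p.Prime := Fact.out
  obtain ⟨s, hs⟩ := hfg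
  -- the typed model `L = K'` of `K' | F₀`, an intermediate field of `Ω | F₀`
  set L : IntermediateField F₀ Ω := Subfield.extendScalars hle
  have hLF : ∀ x : Ω, x ∈ L ↔ x ∈ K' := fun x => Subfield.mem_extendScalars hle
  have hLs : L = IntermediateField.adjoin F₀ (s : Set Ω) := by
    ext x
    rw [hLF, mem_adjoin_subfield_iff, hs]
  haveI : Algebra.EssFiniteType F₀ L := by
    rw [hLs]
    exact IntermediateField.essFiniteType_iff.mpr (IntermediateField.fg_adjoin_finset s)
  -- Mac Lane's hypothesis: `p`-th powers of `F₀`-linearly independent families stay independent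
  have H : ∀ t : Finset L, LinearIndepOn F₀ _root_.id (t : Set L) →
      LinearIndepOn F₀ (· ^ p) (t : Set L) := by
    intro t ht
    have ht' : LinearIndependent F₀ (fun x : (t : Set L) => (x : L)) := ht
    -- independence of the family read in `Ω`
    have hli : LinearIndependent F₀ (fun x : (t : Set L) => ((x : L) : Ω)) :=
      ht'.map' L.val.toLinearMap (LinearMap.ker_eq_bot.mpr fun a b h => Subtype.ext h)
    rw [LinearIndepOn]
    apply LinearIndependent.of_comp L.val.toLinearMap
    rw [Fintype.linearIndependent_iff]
    intro g hg
    -- `hg : ∑ g x • (x : Ω) ^ p = 0`; take `p`-th roots of the coefficients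
    have hg' : ∑ x, (g x : Ω) * ((x : L) : Ω) ^ p = 0 := by
      refine Eq.trans (Finset.sum_congr rfl fun x _ => ?_) hg
      simp only [Function.comp_apply, AlgHom.toLinearMap_apply, map_pow,
        IntermediateField.coe_val, Algebra.smul_def]
      rfl
    choose d hd using fun x : (t : Set L) => IsAlgClosed.exists_pow_nat_eq (g x : Ω) hp.pos
    have hsum : ∑ x, d x * ((x : L) : Ω) = 0 := by
      have h1 : (∑ x, d x * ((x : L) : Ω)) ^ p = 0 := by
        rw [sum_pow_char p, ← hg']
        refine Finset.sum_congr rfl fun x _ => ?_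
        rw [mul_pow, hd]
      exact (pow_eq_zero_iff hp.ne_zero).mp h1
    have hd0 := linDisjoint_of_fintype p F₀ K' hld d (fun x => ((x : L) : Ω))
      (fun x => (hd x).symm ▸ (g x).2) (fun x => (hLF _).mp (x : L).2) hli hsum
    intro x
    have h0 : (g x : Ω) = 0 := by rw [← hd x, hd0 x, zero_pow hp.ne_zero]
    exact_mod_cast h0
  obtain ⟨s₀, hs₀, hsep⟩ :=
    exists_isTranscendenceBasis_and_isSeparable_of_linearIndepOn_pow_of_essFiniteType p hp H
  -- back to `Ω` (as in `separablyGeneratedOver_of_perfectField`)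
  set t : Finset Ω := s₀.image Subtype.val with ht
  have hims : Subtype.val '' (s₀ : Set L) = (t : Set Ω) := by
    rw [ht, Finset.coe_image]
  refine ⟨t, ?_, ?_, ?_⟩
  · intro x hx
    obtain ⟨y, -, rfl⟩ := Finset.mem_image.mp hx
    exact (hLF _).mp y.2
  · -- algebraic independence in `Ω`
    have he : ∀ x : t, ∃ y : s₀, ((y : L) : Ω) = (x : Ω) := fun x => by
      obtain ⟨y, hy, hyx⟩ := Finset.mem_image.mp x.2
      exact ⟨⟨y, hy⟩, hyx⟩
    choose e he using he
    have hinj : Function.Injective e := fun a b hab =>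
      Subtype.ext (by rw [← he a, ← he b, hab])
    have h1 := (hs₀.1.comp e hinj).map' (f := L.val) fun a b h => Subtype.ext h
    convert h1 using 1
    funext x
    exact (he x).symm
  · intro x hxF
    have hxL : x ∈ L := (hLF x).mpr hxF
    have h1 : IsSeparable (IntermediateField.adjoin F₀ (s₀ : Set L)) (⟨x, hxL⟩ : L) :=
      Algebra.IsSeparable.isSeparable _ _
    have h2 : IsSeparable (IntermediateField.adjoin F₀ (s₀ : Set L)) x := by
      have hmin := minpoly.algebraMap_eq (A := IntermediateField.adjoin F₀ (s₀ : Set L))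
        (algebraMap L Ω).injective (⟨x, hxL⟩ : L)
      change (minpoly _ x).Separable
      have hx' : (algebraMap L Ω) ⟨x, hxL⟩ = x := rfl
      rw [hx'] at hmin
      rw [hmin]
      exact h1
    have hPs : ∀ y : IntermediateField.adjoin F₀ (s₀ : Set L),
        ((y : L) : Ω) ∈ IntermediateField.adjoin F₀ (t : Set Ω) := by
      intro y
      have hy : ((y : L) : Ω) ∈ IntermediateField.lift (IntermediateField.adjoin F₀ (s₀ : Set L)) :=
        (IntermediateField.mem_lift (y : L)).mpr y.2
      rwa [IntermediateField.lift_adjoin, hims] at hy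
    let f : IntermediateField.adjoin F₀ (s₀ : Set L) →+* IntermediateField.adjoin F₀ (t : Set Ω) :=
      { toFun := fun y => ⟨((y : L) : Ω), hPs y⟩
        map_one' := rfl
        map_mul' := fun _ _ => rfl
        map_zero' := rfl
        map_add' := fun _ _ => rfl }
    exact isSeparable_of_ringHom_comp_eq f (RingHom.ext fun _ => rfl) h2

end Summit.ResolutionOfSingularities.ResolutionOfSingularities.Theorems

end
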